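import Summits.CriticalPhenomena.CardyFormulaZ2.Theorems.CardySelfDualSegmentUniformMarginalityRestatedRoute

/-!
# RESTATEMENT CERTIFICATE (workfile, not a proposal) — route `CardySelfDualSegment` with the crux
# `UniformMarginality` weakened to RECTILINEAR conformal rectangles

Lead prover-line-stmt-CriticalPhenomena-5472-c2-0 (crux stmt-CriticalPhenomena-5472, line `Sketch`). This file
spells out, in the EXACT `let`-style of the gate-written route file
`Summits/CriticalPhenomena/CardyFormulaZ2/Theses/CardySelfDualSegment.lean`, the three restated items the lead
recommends to the planner —

* `UniformMarginalityRect` : the crux with the rectilinearity hypothesis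
  `(∃ S : Finset (ℂ × ℂ), (∀ p ∈ S, p.1.re = p.2.re ∨ p.1.im = p.2.im) ∧ frontier R.carrier ⊆ ⋃ p ∈ S, segment ℝ p.1 p.2) →`
  inserted after `(R : …ConformalRectangle)` (= stub (B₁) of line `Sketch`);
* `SegmentOpenRect` : `SegmentOpen` with its UM antecedent replaced by the body of `UniformMarginalityRect`;
* `SegmentClosedRect` : `SegmentClosed` likewise —

and CHECKS (all proofs below compile against the tree after p137344, p137582, p137735):

* `segmentClosedRect_holds : SegmentClosedRect` — PROVED NOW (`segmentClosed_of_rectilinearMarginality`), so the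
  restated route has one research crux fewer;
* `closesRect : SegmentOpenRect → UniformMarginalityRect → UniformBoxCrossing → SmirnovBasePoint →
  QuarterTurnPinning → CrudeToCanonical → CardyFormulaZ2` — the restated deciding theorem
  (`closes_of_rectilinearMarginality`), `UniformBoxCrossing`, `SmirnovBasePoint`, `QuarterTurnPinning`,
  `CrudeToCanonical`, `Target` being the route's UNCHANGED decls;
* `uniformMarginality_of_rect : SegmentOpenRect → UniformMarginalityRect → UniformBoxCrossing → SmirnovBasePoint →
  UniformMarginality` — the crux AS FILED is a corollary of the restated cruxes;
* bookkeeping: `uniformMarginalityRect_of : UniformMarginality → UniformMarginalityRect` (the restated crux is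
  WEAKER), `segmentOpen_of_rect : SegmentOpenRect → SegmentOpen` (the restated SegmentOpen is STRONGER — the one new
  obligation the restatement creates; by (W) `cardyLimit_of_rectilinear` its conclusion `t ∈ G` may be certified on
  rectilinear test domains), `uniformMarginalityRect_iff_B₁` (the restated crux is literally stub (B₁)).
-/

noncomputable section

namespace Summit.CriticalPhenomena.CardyFormulaZ2.Cruxes.UniformMarginality.HeatFlow.Restatement

open scoped BigOperators Topology Manifold Classical MeasureTheory ProbabilityTheory Matrix InnerProductSpace ComplexConjugate ContinuousMap
open Filter Set Function TopologicalSpace MeasureTheory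
open Summit.CriticalPhenomena.CardyFormulaZ2.Theses.CardySelfDualSegment

/-- RESTATED CRUX (proposed text for item stmt-CriticalPhenomena-5472): QUANTITATIVE MARGINALITY of the self-dual
deformation ON RECTILINEAR CONFORMAL RECTANGLES — for every t₀ ∈ [0,1], every conformal rectangle R whose boundary is
covered by finitely many axis-parallel segments and ε > 0 there is η > 0 such that |P_t(R, δ) − P_(t₀)(R, δ)| < ε for
all t with |t − t₀| < η and ALL meshes δ > 0. -/
def UniformMarginalityRect : Prop :=
  let prm : unitInterval → Literature.Probability.LatticeModels.Site 2 × Fin 2 → unitInterval := fun t i => if i.2 = 0 then Literature.Probability.Percolation.half else Literature.Probability.Percolation.half * t; let cfg : Set (Literature.Probability.LatticeModels.Site 2 × Fin 2) → Literature.Probability.Percolation.BondConfig (Literature.Probability.LatticeModels.Site 2) := fun S => {e | ∃ v : Literature.Probability.LatticeModels.Site 2, (e = s(v, v + ![1, 0]) ∧ (v, (0 : Fin 2)) ∈ S) ∨ (e = s(v, v + ![0, 1]) ∧ ((v, (0 : Fin 2)) ∈ S ↔ (v, (1 : Fin 2)) ∉ S))}; let P : unitInterval → Literature.Probability.RandomPlanarGeometry.ConformalRectangle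 → ℝ → ℝ := fun t R δ => (Literature.Probability.LatticeModels.prodBernoulli (prm t)).real {S | cfg S ∈ Literature.Probability.Percolation.embDomainCrossing Literature.Probability.LatticeModels.squareLatticeEmbedding.z R.carrier δ (R.arc 0) (R.arc 2)}; (∀ (t₀ : unitInterval) (R : Literature.Probability.RandomPlanarGeometry.ConformalRectangle), (∃ S : Finset (ℂ × ℂ), (∀ p ∈ S, p.1.re = p.2.re ∨ p.1.im = p.2.im) ∧ frontier R.carrier ⊆ ⋃ p ∈ S, segment ℝ p.1 p.2) → ∀ (ε : ℝ), 0 < ε → ∃ η > 0, ∀ t : unitInterval, dist t t₀ < η → ∀ δ : ℝ, 0 < δ → |P t R δ - P t₀ R δ| < ε)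

/-- RESTATED `SegmentOpen` (proposed text for item stmt-CriticalPhenomena-5471): assuming uniform marginality ON
RECTILINEAR CONFORMAL RECTANGLES, the good set G is open in [0,1]. (By `HeatFlow.cardyLimit_of_rectilinear`, p137344,
membership `t ∈ G` may be certified on rectilinear test domains R′.) -/
def SegmentOpenRect : Prop :=
  let prm : unitInterval → Literature.Probability.LatticeModels.Site 2 × Fin 2 → unitInterval := fun t i => if i.2 = 0 then Literature.Probability.Percolation.half else Literature.Probability.Percolation.half * t; let cfg : Set (Literature.Probability.LatticeModels.Site 2 × Fin 2) → Literature.Probability.Percolation.BondConfig (Literature.Probability.LatticeModels.Site 2) := fun S => {e | ∃ v : Literature.Probability.LatticeModels.Site 2, (e = s(v, v + ![1, 0]) ∧ (v, (0 : Fin 2)) ∈ S) ∨ (e = s(v, v + ![0, 1]) ∧ ((v, (0 : Fin 2)) ∈ S ↔ (v, (1 : Fin 2)) ∉ S))}; let P : unitInterval → Literature.Probability.RandomPlanarGeometry.ConformalRectangle → ℝ → ℝ := fun t R δ => (Literature.Probability.LatticeModels.prodBernoulli (prm t)).real {S | cfg S ∈ Literature.Probability.Percolation.embDomainCrossing Literature.Probability.LatticeModels.squareLatticeEmbedding.z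 R.carrier δ (R.arc 0) (R.arc 2)}; let CardyMod : unitInterval → ℂ → Prop := fun t α => ∀ (R R' : Literature.Probability.RandomPlanarGeometry.ConformalRectangle) (φ : Literature.Probability.RandomPlanarGeometry.ConformalEquiv UpperHalfPlane.upperHalfPlaneSet R.carrier) (x : Fin 4 → ℝ), R.carrier = Literature.Barriers.CriticalPhenomena.moduliShear α '' R'.carrier → (∀ i, R.pt i = Literature.Barriers.CriticalPhenomena.moduliShear α (R'.pt i)) → R.IsUniformizing φ x → Filter.Tendsto (P t R') (nhdsWithin 0 (Set.Ioi 0)) (nhds (Literature.Probability.RandomPlanarGeometry.cardyFunction (Literature.Probability.RandomPlanarGeometry.crossRatio x))); let G : Set unitInterval := {t | ∃ α : ℂ, 0 < α.im ∧ CardyMod t α}; (∀ (t₀ : unitInterval) (R : Literature.Probability.RandomPlanarGeometry.ConformalRectangle), (∃ S : Finset (ℂ × ℂ), (∀ p ∈ S, p.1.re = p.2.re ∨ p.1.im = p.2.im) ∧ frontier R.carrier ⊆ ⋃ p ∈ S, segment ℝ p.1 p.2) → ∀ (ε : ℝ), 0 < ε → ∃ η > 0, ∀ t : unitInterval, dist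 t t₀ < η → ∀ δ : ℝ, 0 < δ → |P t R δ - P t₀ R δ| < ε) → IsOpen G

/-- RESTATED `SegmentClosed` (proposed text for item stmt-CriticalPhenomena-5473, or simply dropped from the cruxes
since it is PROVED below): assuming the uniform box-crossing property along the segment and uniform marginality ON
RECTILINEAR CONFORMAL RECTANGLES, G is closed in [0,1]. -/
def SegmentClosedRect : Prop :=
  let prm : unitInterval → Literature.Probability.LatticeModels.Site 2 × Fin 2 → unitInterval := fun t i => if i.2 = 0 then Literature.Probability.Percolation.half else Literature.Probability.Percolation.half * t; let cfg : Set (Literature.Probability.LatticeModels.Site 2 × Fin 2) → Literature.Probability.Percolation.BondConfig (Literature.Probability.LatticeModels.Site 2) := fun S => {e | ∃ v : Literature.Probability.LatticeModels.Site 2, (e = s(v, v + ![1, 0]) ∧ (v, (0 : Fin 2)) ∈ S) ∨ (e = s(v, v + ![0, 1]) ∧ ((v, (0 : Fin 2)) ∈ S ↔ (v, (1 : Fin 2)) ∉ S))}; let P : unitInterval → Literature.Probability.RandomPlanarGeometry.ConformalRectangle → ℝ → ℝ := fun t R δ => (Literature.Probability.LatticeModels.prodBernoulli (prm t)).real {S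 | cfg S ∈ Literature.Probability.Percolation.embDomainCrossing Literature.Probability.LatticeModels.squareLatticeEmbedding.z R.carrier δ (R.arc 0) (R.arc 2)}; let CardyMod : unitInterval → ℂ → Prop := fun t α => ∀ (R R' : Literature.Probability.RandomPlanarGeometry.ConformalRectangle) (φ : Literature.Probability.RandomPlanarGeometry.ConformalEquiv UpperHalfPlane.upperHalfPlaneSet R.carrier) (x : Fin 4 → ℝ), R.carrier = Literature.Barriers.CriticalPhenomena.moduliShear α '' R'.carrier → (∀ i, R.pt i = Literature.Barriers.CriticalPhenomena.moduliShear α (R'.pt i)) → R.IsUniformizing φ x → Filter.Tendsto (P t R') (nhdsWithin 0 (Set.Ioi 0)) (nhds (Literature.Probability.RandomPlanarGeometry.cardyFunction (Literature.Probability.RandomPlanarGeometry.crossRatio x))); let G : Set unitInterval := {t | ∃ α : ℂ, 0 < α.im ∧ CardyMod t α}; (∀ ρ : ℝ, 0 < ρ → ∃ c > 0, ∃ n₀ : ℕ, ∀ t : unitInterval, Literature.Probability.LatticeModels.BoxCrossingBounds ((Literature.Probability.LatticeModels.prodBernoulli (prm t)).map cfg) Literature.Probability.LatticeModels.squareLatticeEmbedding.z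 ρ c n₀) → (∀ (t₀ : unitInterval) (R : Literature.Probability.RandomPlanarGeometry.ConformalRectangle), (∃ S : Finset (ℂ × ℂ), (∀ p ∈ S, p.1.re = p.2.re ∨ p.1.im = p.2.im) ∧ frontier R.carrier ⊆ ⋃ p ∈ S, segment ℝ p.1 p.2) → ∀ (ε : ℝ), 0 < ε → ∃ η > 0, ∀ t : unitInterval, dist t t₀ < η → ∀ δ : ℝ, 0 < δ → |P t R δ - P t₀ R δ| < ε) → IsClosed G

/-- The restated `SegmentClosed` is PROVED (landed p137582). -/
theorem segmentClosedRect_holds : SegmentClosedRect := by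
  intro hX hM
  exact segmentClosed_of_rectilinearMarginality hX hM

/-- The restated deciding theorem (landed p137735, `closes_of_rectilinearMarginality`): the route closes the
sub-problem from SegmentOpenRect, UniformMarginalityRect, UniformBoxCrossing, SmirnovBasePoint, QuarterTurnPinning
(proved), CrudeToCanonical (proved). -/
theorem closesRect : SegmentOpenRect → UniformMarginalityRect → UniformBoxCrossing → SmirnovBasePoint →
    QuarterTurnPinning → CrudeToCanonical → _root_.CardyFormulaZ2 := by
  intro hO hM hX hB hQ hD
  exact closes_of_rectilinearMarginality hO hM hX hB hQ hD

/-- The restated sweep gives the UNCHANGED Target. -/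
theorem targetRect : SegmentOpenRect → UniformMarginalityRect → UniformBoxCrossing → SmirnovBasePoint → Target := by
  intro hO hM hX hB
  exact target_of_rectilinearMarginality hO hM hX hB

/-- The crux AS FILED is a corollary of the restated cruxes (landed p137735, `uniformMarginality_of_restatedCruxes`). -/
theorem uniformMarginality_of_rect :
    SegmentOpenRect → UniformMarginalityRect → UniformBoxCrossing → SmirnovBasePoint → UniformMarginality := by
  intro hO hM hX hB
  exact uniformMarginality_of_restatedCruxes hO hM hX hB

/-- Bookkeeping: the crux as filed implies the restated crux. -/
theorem uniformMarginalityRect_of (h : UniformMarginality) : UniformMarginalityRect := by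
  intro t₀ R _hR ε hε
  exact h t₀ R ε hε

/-- Bookkeeping: the restated `SegmentOpen` implies `SegmentOpen` as filed. -/
theorem segmentOpen_of_rect (h : SegmentOpenRect) : SegmentOpen := by
  intro hM
  exact h (uniformMarginalityRect_of hM)

/-- Bookkeeping: the restated crux is LITERALLY stub (B₁) of line `Sketch` (`HeatFlow.IntegratedBound` on rectilinear
domains), via `uniformMarginalityRect_iff_integratedBoundRectilinear` (p137344). -/
theorem uniformMarginalityRect_iff_B₁ : UniformMarginalityRect ↔
    (∀ R : Literature.Probability.RandomPlanarGeometry.ConformalRectangle,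
      (∃ S : Finset (ℂ × ℂ), (∀ p ∈ S, p.1.re = p.2.re ∨ p.1.im = p.2.im) ∧
        frontier R.carrier ⊆ ⋃ p ∈ S, segment ℝ p.1 p.2) →
      ∀ t₀ : ℝ, t₀ ∈ Set.Icc (0 : ℝ) 1 → ∀ ε > 0, ∃ η > 0,
        ∀ δ : ℝ, 0 < δ → ∀ t ∈ Set.Icc (0 : ℝ) 1, |t - t₀| < η → |Pext R δ t - Pext R δ t₀| < ε) :=
  uniformMarginalityRect_iff_integratedBoundRectilinear

end Summit.CriticalPhenomena.CardyFormulaZ2.Cruxes.UniformMarginality.HeatFlow.Restatement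

end
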